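import Mathlib.RingTheory.Idempotents
import Mathlib.Algebra.Algebra.Subalgebra.Operations
import Mathlib.Algebra.Ring.Action.Group
import Mathlib.Algebra.BigOperators.GroupWithZero.Action
import Mathlib.GroupTheory.GroupAction.Defs
import Mathlib.RingTheory.Ideal.Quotient.Operations
import Literature.RingTheory.Idempotents.RankOneProjectors
import HarnessLib

/-!
# Invariants of a ring under a group permuting a finite family of orthogonal idempotents:
# `(∏_{G/H} B)^G ≃ B^H` and the orbit blocks of the ring of invariants
# (Knus–Merkurjev–Rost–Tignol, *The Book of Involutions*, proof of Prop. (18.18); Lam, *A First Course in Noncommutative Rings*, §22)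

Topic `Literature/RingTheory/Idempotents`, namespace `Literature.RingTheory.Idempotents`.  THEOREMS only (no def, no
instance, no notation, no named fact, no `sorry`).  Cell `hodgecm-mathlib` (D-0151), FLOOR 0, programme F0P5a, crux item
stmt-HodgeConjecture-24832 — generic commutative-algebra capital for MOD-PLAN v0.4 row L6.6 / census `C3-LEVELS-census.v1` §5
(B2) «the special fibre `X_s ⧸ G` of a tame quotient of a smooth relative curve is normal»: the fibre chart `Spec A` of `X_s`
is a finite product of integrally closed domains whose primitive idempotents the group PERMUTES, and one needs the ring of
invariants `A^G` block by block («induced-ring lemma»).  Nothing here is specific to curves or to schemes; `G` need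
not be finite (only the family of idempotents / the orbit in question is).  FILE 1 of 2: the sequel
`InvariantsOfPermutedBlocksNormal` transfers NORMALITY (integrally closed domain blocks) to the orbit blocks of `A^G`.

## Setting

`A` a commutative ring with an action of a group `G` by ring automorphisms (`MulSemiringAction G A`), `ι` a `G`-set
(`MulAction G ι`) and `e : ι → A` a `G`-EQUIVARIANT family of pairwise orthogonal idempotents
(`hge : ∀ g i, g • e i = e (g • i)`).  The ring of invariants is Mathlib's `FixedPoints.subring A G`; membership is
`∀ g, g • a = a` (definitionally), and the elementary statements below are phrased with that hypothesis
so that they apply verbatim to elements of any invariant subring.  The BLOCK of an idempotent `f` of a commutative ring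
`R` is `R ⧸ (1 - f)` (Mathlib `CompleteOrthogonalIdempotents.bijective_pi`: `R ≅ ∏ᵢ R ⧸ (1 - eᵢ)`); for the block at
`e i₀` we allow ANY surjection `τ : A →+* B` with `τ a = 0 ↔ e i₀ * a = 0` (e.g. `Ideal.Quotient.mk _`,
`mk_span_one_sub_eq_zero_iff`), so that no action on a quotient ring has to be constructed: invariance under the
stabiliser `H = Stab_G(i₀)` is expressed upstairs as `τ (h • x) = τ x`.

## Contents

* §0 A `MulSemiringAction` permutes the PRIMITIVE idempotents (`isPrimitiveIdempotent_smul_iff`), and a complete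
  orthogonal family of primitive idempotents of a commutative ring exhausts them (`exists_eq_of_isPrimitiveIdempotent`,
  `range_eq_setOf_isPrimitiveIdempotent`, `injective_of_orthogonalIdempotents`) — this is how a consumer manufactures the
  `G`-set `ι` (the primitive idempotents, a `SubMulAction`) and `hge`.
* §1 Sums of `e` over a `G`-STABLE finite set of indices are invariant (`smul_sum_eq_sum_of_stable`); block sums over
  the fibres of a `G`-invariant colouring `c : ι → κ` (e.g. the orbit map) are invariant and form a complete orthogonal
  family (`completeOrthogonalIdempotents_fiberSum`); products of block sums (`sum_mul_sum_eq_sum_inter`).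
* §2 THE TRANSITIVE PIECE «`(∏_{G/H} B)^G ≃ B^H`»: for the orbit `O` of `i₀` (given as a `Finset` with its membership
  specification `hO : j ∈ O ↔ ∃ g, g • i₀ = j`) and `ε = ∑_{j ∈ O} e j`:
  an invariant `a` with `e i₀ * a = 0` has `ε * a = 0` (`orbitSum_mul_eq_zero_of_invariant`: the `G`-invariants of the
  `ε`-block INJECT into the block at `e i₀`), and an `H`-invariant element `x = e i₀ x` of the corner is `e i₀ * a` for an
  invariant `a = ε a` (`exists_invariant_of_stabilizer`: the coset sum `a = ∑_{j ∈ O} g_j • x`, `g_j i₀ = j` — they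
  SURJECT onto the `H`-invariants); the same two facts through a block surjection `τ : A → B`, `τ a = 0 ↔ e i₀ a = 0`,
  are in the sequel file (`exists_invariant_map_eq` etc.).
* The orbit blocks themselves: `A^G` carries the complete orthogonal family `ε_k = ∑_{j ∈ k} e j`, `k ∈ ι/G`
  (`exists_completeOrthogonalIdempotents_fixedPoints_orbitSum`), so `A^G ≅ ∏_k A^G ⧸ (1 - ε_k)` by Mathlib
  `CompleteOrthogonalIdempotents.bijective_pi`, and by §2 each `A^G ⧸ (1 - ε_k)` embeds into the block of `A` at any
  `e i₀`, `i₀ ∈ k`, with image the `Stab_G(i₀)`-invariants.  (§3, the NORMALITY transfer, is the sequel file.)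

Deliberately NOT here: normality (sequel file); the scheme-level statements (stable affine charts of `X_s`, gluing),
finiteness / dimension of `A^G`, and smoothness of normal curves over perfect fields (all ★ elsewhere in the tree); the
identification of the primitive idempotents of a fibre chart with its connected components is left to the consumer (§0
gives the permutation action and the exhaustion statement it needs); no action on a quotient or corner ring is
constructed (hypotheses `τ (h • x) = τ x` instead).

HC_CM is proved only modulo the 7 printed citations until rung 0 closes; this file is a generic leaf and changes no count.

## References
* [KnusEtAl1998] M.-A. Knus, A. Merkurjev, M. Rost, J.-P. Tignol, *The Book of Involutions*, AMS Coll. Publ. 44 (1998),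
  §18.B, proof of Prop. (18.18) (p. 366): the conjugates `g_i(e)` of a primitive idempotent, the coset decomposition
  `G = ∐ g_i H`, and the averaging argument `e (∑ g_i(e ℓ)) = e ℓ` giving `M^H` from `L^G` — here for rings instead of
  Galois algebras over a field (the field case is the tree's `Literature.FieldTheory.Galois.corner_fixedPoints_eq_bot`).
* [Lam2001FirstCourse] T. Y. Lam, *A First Course in Noncommutative Rings*, 2nd ed., §21 Prop. (21.8), §22 (primitive
  idempotents, block decompositions).
-/

set_option autoImplicit false

namespace Literature.RingTheory.Idempotents

section Basic

variable {A : Type*} [CommRing A]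

/-- For an idempotent `f` of a commutative ring, `f * a = 0 ↔ a ∈ (1 - f)` (if `f a = 0` then `a = (1 - f) a`; if
`a = (1 - f) b` then `f a = (f - f²) b = 0`): the kernel of the projection onto the block `A ⧸ (1 - f)` is the annihilator
of `f`. [cite: Lam2001FirstCourse, §22 (block decomposition), p. 326] -/
theorem mul_eq_zero_iff_mem_span_one_sub {f : A} (hf : IsIdempotentElem f) (a : A) :
    f * a = 0 ↔ a ∈ Ideal.span {1 - f} := by
  rw [Ideal.mem_span_singleton]
  constructor
  · intro h
    exact ⟨a, by rw [sub_mul, one_mul, h, sub_zero]⟩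
  · rintro ⟨b, rfl⟩
    rw [← mul_assoc, mul_sub, mul_one, hf.eq, sub_self, zero_mul]

/-- The block projection `A → A ⧸ (1 - f)` kills exactly the annihilator of the idempotent `f`:
`mk a = 0 ↔ f * a = 0`. [cite: Lam2001FirstCourse, §22 (block decomposition), p. 326] -/
theorem mk_span_one_sub_eq_zero_iff {f : A} (hf : IsIdempotentElem f) (a : A) :
    Ideal.Quotient.mk (Ideal.span {1 - f}) a = 0 ↔ f * a = 0 := by
  rw [Ideal.Quotient.eq_zero_iff_mem, mul_eq_zero_iff_mem_span_one_sub hf]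

/-- Two elements have the same image in the block `A ⧸ (1 - f)` iff they have the same `f`-component:
`mk a = mk b ↔ f * a = f * b`. [cite: Lam2001FirstCourse, §22 (block decomposition), p. 326] -/
theorem mk_span_one_sub_eq_mk_iff {f : A} (hf : IsIdempotentElem f) (a b : A) :
    Ideal.Quotient.mk (Ideal.span {1 - f}) a = Ideal.Quotient.mk (Ideal.span {1 - f}) b ↔ f * a = f * b := by
  rw [Ideal.Quotient.mk_eq_mk_iff_sub_mem, ← mul_eq_zero_iff_mem_span_one_sub hf, mul_sub, sub_eq_zero]

end Basic

/-! ### §0 A ring action permutes the primitive idempotents; a complete family of primitive idempotents exhausts them -/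

section Primitive

variable {A : Type*} [CommRing A] {G : Type*} [Group G] [MulSemiringAction G A]

/-- **A group acting by ring automorphisms permutes the primitive idempotents**: `g • f` is a primitive idempotent iff
`f` is (transport along the ring automorphism `MulSemiringAction.toRingEquiv G A g`). [cite: KnusEtAl1998, Prop. (18.18) (proof)] -/
theorem isPrimitiveIdempotent_smul_iff (g : G) {f : A} :
    IsPrimitiveIdempotent (g • f) ↔ IsPrimitiveIdempotent f :=
  isPrimitiveIdempotent_map_ringEquiv_iff (MulSemiringAction.toRingEquiv G A g)

/-- Members of a family of pairwise orthogonal NON-ZERO idempotents are pairwise distinct: the family is injective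
(`e i = e j` with `i ≠ j` would give `e i = e i e j = 0`). [cite: Lam2001FirstCourse, §22 (block decomposition), p. 326] -/
theorem injective_of_orthogonalIdempotents {ι : Type*} {e : ι → A} (he : OrthogonalIdempotents e)
    (hne : ∀ i, e i ≠ 0) : Function.Injective e := by
  intro i j hij
  by_contra h
  apply hne i
  have h1 : e i * e j = 0 := he.ortho h
  rwa [← hij, (he.idem i).eq] at h1

/-- **A complete orthogonal family of primitive idempotents of a commutative ring contains every primitive idempotent**:
if `f` is primitive then `f = ∑ᵢ f eᵢ` with each `f eᵢ` a sub-idempotent of `f`, so some `f eᵢ = f`, i.e. `f ≤ eᵢ`, and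
then `f = eᵢ` by primitivity of `eᵢ`. [cite: Lam2001FirstCourse, §21 Prop. (21.8) and §22 p. 326] -/
theorem exists_eq_of_isPrimitiveIdempotent {ι : Type*} [Fintype ι] {e : ι → A} (he : CompleteOrthogonalIdempotents e)
    (hprim : ∀ i, IsPrimitiveIdempotent (e i)) {f : A} (hf : IsPrimitiveIdempotent f) : ∃ i, f = e i := by
  have hfi : ∀ i, IsIdempotentElem (f * e i) := fun i =>
    (hf.isIdempotentElem.mul_of_commute (Commute.all f (e i)) (he.idem i))
  -- each `f eᵢ` is `0` or `f`
  have hcases : ∀ i, f * e i = 0 ∨ f * e i = f := fun i =>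
    hf.eq_zero_or_eq (f * e i) (hfi i) (by rw [mul_right_comm, hf.isIdempotentElem.eq])
      (by rw [← mul_assoc, hf.isIdempotentElem.eq])
  -- not all of them vanish, since `∑ᵢ f eᵢ = f ≠ 0`
  have hsum : ∑ i, f * e i = f := by rw [← Finset.mul_sum, he.complete, mul_one]
  obtain ⟨i, hi⟩ : ∃ i, f * e i = f := by
    by_contra h
    push Not at h
    apply hf.ne_zero
    rw [← hsum]
    exact Finset.sum_eq_zero fun i _ => (hcases i).resolve_right (h i)
  refine ⟨i, ?_⟩
  rcases (hprim i).eq_zero_or_eq f hf.isIdempotentElem hi (by rw [mul_comm, hi]) with h0 | h1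
  · exact (hf.ne_zero h0).elim
  · exact h1

/-- For a complete orthogonal family of PRIMITIVE idempotents of a commutative ring, the members of the family are
exactly the primitive idempotents of the ring. [cite: Lam2001FirstCourse, §21 Prop. (21.8) and §22 p. 326] -/
theorem range_eq_setOf_isPrimitiveIdempotent {ι : Type*} [Fintype ι] {e : ι → A} (he : CompleteOrthogonalIdempotents e)
    (hprim : ∀ i, IsPrimitiveIdempotent (e i)) : Set.range e = {f | IsPrimitiveIdempotent f} := by
  ext f
  constructor
  · rintro ⟨i, rfl⟩
    exact hprim i
  · intro hf
    obtain ⟨i, rfl⟩ := exists_eq_of_isPrimitiveIdempotent he hprim hf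
    exact ⟨i, rfl⟩

/-- **The action permutes a complete orthogonal family of primitive idempotents**: `g • e i` is again a member of the
family, `g • e i = e j` for a unique `j` (existence here; uniqueness is `injective_of_orthogonalIdempotents`).  This is the
datum `hge : g • e i = e (g • i)` of the rest of the file, for the induced permutation action on the index set.
[cite: KnusEtAl1998, Prop. (18.18) (proof)] -/
theorem exists_smul_eq_of_isPrimitiveIdempotent {ι : Type*} [Fintype ι] {e : ι → A} (he : CompleteOrthogonalIdempotents e)
    (hprim : ∀ i, IsPrimitiveIdempotent (e i)) (g : G) (i : ι) : ∃ j, g • e i = e j :=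
  exists_eq_of_isPrimitiveIdempotent he hprim ((isPrimitiveIdempotent_smul_iff g).2 (hprim i))

end Primitive

/-! ### §1 Invariant block sums -/

section BlockSums

variable {A : Type*} [CommRing A] {G : Type*} [Group G] [MulSemiringAction G A]
variable {ι : Type*} [MulAction G ι] {e : ι → A}

/-- Equivariance in use: `g • (e i * x) = e (g • i) * (g • x)`. [cite: KnusEtAl1998, Prop. (18.18) (proof)] -/
theorem smul_idem_mul (hge : ∀ (g : G) (i : ι), g • e i = e (g • i)) (g : G) (i : ι) (x : A) :
    g • (e i * x) = e (g • i) * g • x := by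
  rw [smul_mul', hge]

/-- **Block sums over a `G`-stable finite set of indices are invariant**: if `g • S ⊆ S` for all `g` then
`g • ∑_{j ∈ S} e j = ∑_{j ∈ S} e (g • j) = ∑_{j ∈ S} e j` (`j ↦ g • j` is a bijection of `S`).
[cite: KnusEtAl1998, Prop. (18.18) (proof)] -/
theorem smul_sum_eq_sum_of_stable (hge : ∀ (g : G) (i : ι), g • e i = e (g • i)) (S : Finset ι)
    (hS : ∀ (g : G) (j : ι), j ∈ S → g • j ∈ S) (g : G) :
    g • (∑ j ∈ S, e j) = ∑ j ∈ S, e j := by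
  rw [Finset.smul_sum]
  simp_rw [hge]
  refine Finset.sum_nbij (fun j => g • j) (fun j hj => hS g j hj) (fun j₁ _ j₂ _ h => smul_left_cancel g h)
    (fun j hj => ?_) (fun _ _ => rfl)
  exact ⟨g⁻¹ • j, hS g⁻¹ j (by simpa using hj), smul_inv_smul g j⟩

/-- Block sums over a `G`-stable finite set of indices lie in the ring of invariants `FixedPoints.subring A G`.
[cite: KnusEtAl1998, Prop. (18.18) (proof)] -/
theorem sum_mem_fixedPoints_subring_of_stable (hge : ∀ (g : G) (i : ι), g • e i = e (g • i)) (S : Finset ι)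
    (hS : ∀ (g : G) (j : ι), j ∈ S → g • j ∈ S) :
    (∑ j ∈ S, e j) ∈ FixedPoints.subring A G :=
  fun g => smul_sum_eq_sum_of_stable hge S hS g

/-- Products of block sums: `(∑_{j ∈ S} e j) (∑_{j ∈ T} e j) = ∑_{j ∈ S ∩ T} e j` for an orthogonal family.
[cite: Lam2001FirstCourse, §22 (block decomposition), p. 326] -/
theorem sum_mul_sum_eq_sum_inter [DecidableEq ι] (he : OrthogonalIdempotents e) (S T : Finset ι) :
    (∑ j ∈ S, e j) * (∑ j ∈ T, e j) = ∑ j ∈ S ∩ T, e j := by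
  rw [Finset.sum_mul]
  have key : ∀ j ∈ S, e j * ∑ k ∈ T, e k = if j ∈ T then e j else 0 := fun j _ => by
    split_ifs with h
    · exact he.mul_sum_of_mem h
    · exact he.mul_sum_of_notMem h
  rw [Finset.sum_congr rfl key, Finset.sum_ite_mem]

/-- Block sums over DISJOINT sets of indices are orthogonal. [cite: Lam2001FirstCourse, §22 (block decomposition), p. 326] -/
theorem sum_mul_sum_eq_zero_of_disjoint (he : OrthogonalIdempotents e) {S T : Finset ι} (hST : Disjoint S T) :
    (∑ j ∈ S, e j) * (∑ j ∈ T, e j) = 0 := by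
  classical
  rw [sum_mul_sum_eq_sum_inter he, Finset.disjoint_iff_inter_eq_empty.1 hST, Finset.sum_empty]

/-- **Block sums over the fibres of a colouring form a complete orthogonal family**: for any map `c : ι → κ` to a finite
type, the sums `ε_k = ∑_{c j = k} e j` of a complete orthogonal family are a complete orthogonal family indexed by `κ`
(empty fibres contribute `0`).  Applied to the orbit map `c = Quotient.mk (MulAction.orbitRel G ι)` these are the ORBIT
BLOCKS of the ring of invariants (`smul_fiberSum_eq_self`). [cite: Lam2001FirstCourse, §22 (block decomposition), p. 326] -/
theorem completeOrthogonalIdempotents_fiberSum [Fintype ι] {κ : Type*} [Fintype κ] [DecidableEq κ]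
    (he : CompleteOrthogonalIdempotents e) (c : ι → κ) :
    CompleteOrthogonalIdempotents (fun k => ∑ j ∈ Finset.univ.filter (fun j => c j = k), e j) where
  idem k := he.toOrthogonalIdempotents.isIdempotentElem_sum
  ortho k k' hkk' := by
    classical
    refine sum_mul_sum_eq_zero_of_disjoint he.toOrthogonalIdempotents ?_
    rw [Finset.disjoint_filter]
    intro j _ hj hj'
    exact hkk' (hj.symm.trans hj')
  complete := Finset.sum_fiberwise Finset.univ c e |>.trans he.complete

/-- The fibres of a `G`-INVARIANT colouring are `G`-stable, so their block sums are invariant: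
`g • ε_k = ε_k`. [cite: KnusEtAl1998, Prop. (18.18) (proof)] -/
theorem smul_fiberSum_eq_self [Fintype ι] {κ : Type*} [DecidableEq κ]
    (hge : ∀ (g : G) (i : ι), g • e i = e (g • i)) (c : ι → κ) (hc : ∀ (g : G) (j : ι), c (g • j) = c j)
    (k : κ) (g : G) :
    g • (∑ j ∈ Finset.univ.filter (fun j => c j = k), e j) = ∑ j ∈ Finset.univ.filter (fun j => c j = k), e j :=
  smul_sum_eq_sum_of_stable hge _ (fun g' j hj => by
    rw [Finset.mem_filter] at hj ⊢
    exact ⟨Finset.mem_univ _, (hc g' j).trans hj.2⟩) g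

/-- The orbit map is an invariant colouring: `⟦g • j⟧ = ⟦j⟧` in `orbitRel.Quotient G ι`. [cite: KnusEtAl1998, Prop. (18.18) (proof)] -/
theorem orbitRel_mk_smul (g : G) (j : ι) :
    (Quotient.mk (MulAction.orbitRel G ι) (g • j) : MulAction.orbitRel.Quotient G ι) =
      Quotient.mk (MulAction.orbitRel G ι) j :=
  Quotient.sound (MulAction.mem_orbit j g)

/-- The fibre of the orbit map over the class of `i₀` is the orbit of `i₀`, in the membership form used in §2:
`⟦j⟧ = ⟦i₀⟧ ↔ ∃ g, g • i₀ = j`. [cite: KnusEtAl1998, Prop. (18.18) (proof)] -/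
theorem mem_filter_orbitRel_iff [Fintype ι] [DecidableEq (MulAction.orbitRel.Quotient G ι)] (i₀ j : ι) :
    j ∈ Finset.univ.filter (fun j => (Quotient.mk (MulAction.orbitRel G ι) j : MulAction.orbitRel.Quotient G ι) =
        Quotient.mk (MulAction.orbitRel G ι) i₀) ↔ ∃ g : G, g • i₀ = j := by
  rw [Finset.mem_filter, and_iff_right (Finset.mem_univ j), Quotient.eq]
  exact MulAction.mem_orbit_iff

/-- A family in a subring whose values form a complete orthogonal family of the ambient ring is a complete orthogonal
family of the subring (Mathlib `CompleteOrthogonalIdempotents.map_injective_iff` for the inclusion). [cite: Lam2001FirstCourse, §22 (block decomposition), p. 326] -/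
theorem completeOrthogonalIdempotents_of_val_eq {κ : Type*} [Fintype κ] {R : Subring A} (ε' : κ → R) {ε : κ → A}
    (hε : CompleteOrthogonalIdempotents ε) (h : ∀ k, (ε' k : A) = ε k) : CompleteOrthogonalIdempotents ε' := by
  have hcomp : (R.subtype ∘ ε') = ε := funext h
  rw [← CompleteOrthogonalIdempotents.map_injective_iff (f := R.subtype) Subtype.val_injective, hcomp]
  exact hε

/-- **The orbit blocks of the ring of invariants.**  For a finite `G`-set `ι` and a `G`-permuted complete orthogonal
family `e`, the ring of invariants `A^G = FixedPoints.subring A G` carries a complete orthogonal family of idempotents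
`ε_k = ∑_{j ∈ k} e j` indexed by the orbits `k ∈ ι/G`; hence `A^G ≅ ∏_k A^G ⧸ (1 - ε_k)` by Mathlib
`CompleteOrthogonalIdempotents.bijective_pi`. [cite: KnusEtAl1998, Prop. (18.18) (proof)] -/
theorem exists_completeOrthogonalIdempotents_fixedPoints_orbitSum [Fintype ι]
    [Fintype (MulAction.orbitRel.Quotient G ι)] [DecidableEq (MulAction.orbitRel.Quotient G ι)]
    (he : CompleteOrthogonalIdempotents e) (hge : ∀ (g : G) (i : ι), g • e i = e (g • i)) :
    ∃ ε' : MulAction.orbitRel.Quotient G ι → FixedPoints.subring A G, CompleteOrthogonalIdempotents ε' ∧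
      ∀ k, (ε' k : A) =
        ∑ j ∈ Finset.univ.filter (fun j => (Quotient.mk (MulAction.orbitRel G ι) j :
          MulAction.orbitRel.Quotient G ι) = k), e j := by
  refine ⟨fun k => ⟨_, fun g => smul_fiberSum_eq_self hge _ (orbitRel_mk_smul) k g⟩, ?_, fun k => rfl⟩
  exact completeOrthogonalIdempotents_of_val_eq _ (completeOrthogonalIdempotents_fiberSum he _) fun k => rfl

end BlockSums

/-! ### §2 The transitive piece: `(∏_{G/H} B)^G ≃ B^H` -/

section Transitive

variable {A : Type*} [CommRing A] {G : Type*} [Group G] [MulSemiringAction G A]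
variable {ι : Type*} [MulAction G ι] {e : ι → A} {i₀ : ι} {O : Finset ι}

/-- The orbit (as a `Finset` with its membership specification) contains the base point. [cite: KnusEtAl1998, Prop. (18.18) (proof)] -/
theorem mem_of_orbitSpec (hO : ∀ j, j ∈ O ↔ ∃ g : G, g • i₀ = j) : i₀ ∈ O :=
  (hO i₀).2 ⟨1, one_smul G i₀⟩

/-- The orbit is `G`-stable. [cite: KnusEtAl1998, Prop. (18.18) (proof)] -/
theorem smul_mem_of_orbitSpec (hO : ∀ j, j ∈ O ↔ ∃ g : G, g • i₀ = j) (g : G) {j : ι} (hj : j ∈ O) :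
    g • j ∈ O := by
  obtain ⟨g', rfl⟩ := (hO j).1 hj
  exact (hO _).2 ⟨g * g', mul_smul g g' i₀⟩

/-- The orbit block sum `ε = ∑_{j ∈ O} e j` is invariant. [cite: KnusEtAl1998, Prop. (18.18) (proof)] -/
theorem smul_orbitSum_eq_self (hge : ∀ (g : G) (i : ι), g • e i = e (g • i))
    (hO : ∀ j, j ∈ O ↔ ∃ g : G, g • i₀ = j) (g : G) : g • (∑ j ∈ O, e j) = ∑ j ∈ O, e j :=
  smul_sum_eq_sum_of_stable hge O (fun g' _ hj => smul_mem_of_orbitSpec hO g' hj) g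

/-- **Injectivity half of `(∏_{G/H} B)^G ≃ B^H`.**  If `a` is `G`-invariant and its `e i₀`-component vanishes, then
its whole orbit block vanishes: `(∑_{j ∈ O} e j) * a = 0` (each `e (g i₀) a = g • (e i₀ a) = 0`).  In words: a
`G`-invariant element of `∏_{j ∈ G i₀} B_j` is determined by its `i₀`-coordinate.
[cite: KnusEtAl1998, Prop. (18.18) (proof)] -/
theorem orbitSum_mul_eq_zero_of_invariant (hge : ∀ (g : G) (i : ι), g • e i = e (g • i))
    (hO : ∀ j, j ∈ O ↔ ∃ g : G, g • i₀ = j) {a : A} (ha : ∀ g : G, g • a = a) (h0 : e i₀ * a = 0) :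
    (∑ j ∈ O, e j) * a = 0 := by
  rw [Finset.sum_mul]
  refine Finset.sum_eq_zero fun j hj => ?_
  obtain ⟨g, rfl⟩ := (hO j).1 hj
  calc e (g • i₀) * a = e (g • i₀) * g • a := by rw [ha g]
    _ = g • (e i₀ * a) := (smul_idem_mul hge g i₀ a).symm
    _ = 0 := by rw [h0, smul_zero]

/-- **Surjectivity half of `(∏_{G/H} B)^G ≃ B^H` (KMRT's averaging argument).**  Let `x = e i₀ x` be an element of the
corner at `e i₀` invariant under the stabiliser `H = Stab_G(i₀)`.  Then `x = e i₀ * a` for a `G`-INVARIANT `a` lying in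
the orbit block (`(∑_{j ∈ O} e j) a = a`): namely `a = ∑_{j ∈ O} g_j • x` for any choice of `g_j ∈ G` with `g_j i₀ = j`
(well defined because `x` is `H`-invariant; `g ∘ g_j` and `g_{g j}` differ by an element of `H`, so `g • a = a`; and
`e i₀ (g_j • x) = e i₀ e j (g_j • x) = 0` for `j ≠ i₀`). [cite: KnusEtAl1998, Prop. (18.18) (proof)] -/
theorem exists_invariant_of_stabilizer (he : OrthogonalIdempotents e)
    (hge : ∀ (g : G) (i : ι), g • e i = e (g • i)) (hO : ∀ j, j ∈ O ↔ ∃ g : G, g • i₀ = j)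
    {x : A} (hx : e i₀ * x = x) (hH : ∀ g : G, g • i₀ = i₀ → g • x = x) :
    ∃ a : A, (∀ g : G, g • a = a) ∧ (∑ j ∈ O, e j) * a = a ∧ e i₀ * a = x := by
  classical
  -- a section `s` of the orbit map on `O`
  have hsec : ∀ j : ι, ∃ g : G, j ∈ O → g • i₀ = j := fun j => by
    by_cases hj : j ∈ O
    · obtain ⟨g, hg⟩ := (hO j).1 hj
      exact ⟨g, fun _ => hg⟩
    · exact ⟨1, fun h => (hj h).elim⟩
  choose s hs using hsec
  -- `s j • x` lies in the corner at `e j`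
  have hcorner : ∀ j ∈ O, s j • x = e j * s j • x := fun j hj => by
    conv_lhs => rw [← hx]
    rw [smul_idem_mul hge, hs j hj]
  refine ⟨∑ j ∈ O, s j • x, fun g => ?_, ?_, ?_⟩
  · -- invariance: `(g * s j) • x = s (g • j) • x`, then reindex by `j ↦ g • j`
    rw [Finset.smul_sum]
    simp_rw [smul_smul]
    have key : ∀ j ∈ O, (g * s j) • x = s (g • j) • x := fun j hj => by
      have hgj : g • j ∈ O := smul_mem_of_orbitSpec hO g hj
      have hstab : ((s (g • j))⁻¹ * (g * s j)) • i₀ = i₀ := by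
        rw [mul_smul, mul_smul, hs j hj, inv_smul_eq_iff, hs (g • j) hgj]
      calc (g * s j) • x = (s (g • j) * ((s (g • j))⁻¹ * (g * s j))) • x := by rw [mul_inv_cancel_left]
        _ = s (g • j) • ((s (g • j))⁻¹ * (g * s j)) • x := mul_smul _ _ _
        _ = s (g • j) • x := by rw [hH _ hstab]
    rw [Finset.sum_congr rfl key]
    exact Finset.sum_nbij (fun j => g • j) (fun j hj => smul_mem_of_orbitSpec hO g hj)
      (fun j₁ _ j₂ _ h => smul_left_cancel g h)
      (fun j hj => ⟨g⁻¹ • j, smul_mem_of_orbitSpec hO g⁻¹ (by simpa using hj), smul_inv_smul g j⟩)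
      (fun _ _ => rfl)
  · -- the sum lies in the orbit block
    rw [Finset.mul_sum]
    refine Finset.sum_congr rfl fun j hj => ?_
    rw [hcorner j hj, ← mul_assoc, mul_comm (∑ k ∈ O, e k) (e j), he.mul_sum_of_mem hj]
  · -- the `i₀`-component is `x`
    rw [Finset.mul_sum, Finset.sum_eq_single_of_mem i₀ (mem_of_orbitSpec hO) fun j hj hji => ?_]
    · rw [hH _ (hs i₀ (mem_of_orbitSpec hO)), hx]
    · rw [hcorner j hj, ← mul_assoc, he.ortho (Ne.symm hji), zero_mul]

end Transitive

end Literature.RingTheory.Idempotents
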